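import Summits.QuantumFields.BalabanUV.T4Continuum.Support.NE3DecomposedRepOfLinearNormalPart
import Summits.QuantumFields.BalabanUV.T4Continuum.Support.NE3DecomposedRepFlat
import HarnessLib

/-!
# T⁴ programme, node NE3, route Π — A-NV FOR THE NEW CHAIN: `ResidualSliceRep` (file 1) AND `ResidualSliceRepT` (file 2) ARE INHABITED AT THE FLAT
# DATUM, AND `decomposedRep_of_linearNormalPart` FIRES THERE (radius `a = 0`)

NE3 formalisation swarm `b2b-balaban-t4-ne3-formalise-*`, LEAF PROVER 04 (gen 7); INTENT HOME/CLAIMS.log l.23543.  The same pattern as this lineage's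
`NE3EndpointChartFlat` (p238189) ∕ `NE3DecomposedRepFlat` (p239011; referee INFO-62∕64): every new hypothesis SHAPE of the route is shown to be inhabited
at the flat datum, and the owner's derivation is exercised there.

CONTENT (all [folklore]; 0 sorry; 0 def):
§1 **`residualSliceRep_flat`** — `ResidualSliceRep L N k flatCfg flatCfg 1 0 α₀` for every `α₀ ≥ 0` (`u = 1` is unitary, periodic and CORNER-TRIVIAL;
   `U_A^1 = flatCfg = flatCfg·e^{0}`; `0` is skew, periodic, frame-free (`NE3DecomposedRepFlat.framePotW_flatCfg_zero`) and `hsR`-orthogonal to everything);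
§2 **`residualSliceRepT_flat`** — `ResidualSliceRepT L N k flatCfg flatCfg 1 0 0 α₀` (the R-adapted form with the linear normal part `Nn = 0`: the tangent datum
   `0 − 0` lies in `T_♮(1)` by `zero_mem_frameFreeBlockLandauW_flatCfg`), and `residualSliceRepT_flat_cavg` (the same at the background `cavg L flatCfg`);
§3 **`decomposedRep_flat_of_linearNormalPart`** — the owner's file-2 END `decomposedRep_of_linearNormalPart` APPLIED at the flat datum (`L, N ≥ 1`, `α₀ = αN = 0`,
   ANY pre-size letters `ν₀ k₁ k₂`, radius `a = 0`): `DecomposedRep flatClass L N (j+1) flatCfg flatCfg flatCfg 1 (0 − 0) (normalPart 0 (0 − 0)) 0 ((1+0)·0) ((1+2048√(16d+1))ν₀)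
   (k₁+8192dk₂) (1806k₂) 0` — every binder of the END ((J1), the three pre-sizes, `small`) discharged at zero data (`normalPart 0 0 = 0` bondwise by `mlog 1 = 0`).

HONEST FRAMING.  Non-vacuity of SHAPES at the flat datum only — nothing about Bałaban's minimisers; `ResidualSliceRep(T)` and (Π-REG) remain typed leaves
at every non-flat pair; NE3 NOT proved; spine PROVED 0∕9; finite T⁴ rung (B)+1 — NOT infinite volume, NOT mass gap, NOT BetaPertH, NOT Clay.  ABSOLUTE
RULE kept (no printed sentence is a hypothesis).  PLACEMENT: `Summits/QuantumFields/BalabanUV/`.  HONEST DEPENDENCY: continuum YM on T⁴ ⇐ BetaPertH ∧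
nine spine estimates (0/9 proved); BetaPertH ⇐ (D1) ∧ (D4) ∧ CAP+tail; G-an2-4 gates asym, D1 and NE2/3/4.
-/

set_option autoImplicit false

open scoped BigOperators Matrix.Norms.L2Operator
open NormedSpace Finset Set

namespace Summit.QuantumFields.BalabanUV.T4Continuum.NE3ResidualSliceRepFlat

open Literature.MathematicalPhysics.QuantumFieldTheory.Balaban1983to89
open B7Prop1Explicit B7Prop2Explicit MatrixLog
open T4AveragingDeficitWall (IsSkewDir IsUnitaryCfg vary vary_zero_dir curl fhol dirL1)
open T4AveragingDeficitWallBoundary (periodBox)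
open AveragingDeficitPeriodicCounting (IsPeriodicDir)
open AveragingDeficitChartCalculus (cavg)
open MinimalActionLevels (perWin)
open MinimalActionSandwich (admissible)
open MinimalActionWitness (flatCfg flatClass flatCfg_mem_admissible fhol_flatCfg)
open NE3EnergyShapes (IsUnitarySite IsPeriodicSite gaugeAct_one)
open NE3EnergyWeightedShapes (energyNormW energyNormW_zero energyNormW_nonneg)
open NE3LandauOrbit (hsR_zero_left)
open NE3FrameFreeSliceW (frameFreeBlockLandauW)
open NE3EndpointChartFlat (cavg_flatCfg)
open NE3ProductPath (pathΓ)
open NE3ProductPathChart (DecomposedRep)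
open NE3ResidualSliceRep (ResidualSliceRep normalPart)
open NE3DecomposedRepOfLinearNormalPart (ResidualSliceRepT decomposedRep_of_linearNormalPart)
open NE3DecomposedRepFlat (flatCfg_classes zero_mem_frameFreeBlockLandauW_flatCfg framePotW_flatCfg_zero pathΓ_zero_zero)
open AveragingDeficitDerivCore (dirL1_nonneg)

noncomputable section

variable {d : ℕ} {n : Type*} [Fintype n] [DecidableEq n]

/-! ## §1 The intrinsic residual slice representative at the flat datum -/

/-- **NON-VACUITY OF `ResidualSliceRep` AT THE FLAT DATUM**: `W = U_A = flatCfg`, `u = 1`, `X₀ = 0`, any `α₀ ≥ 0` (`L ≥ 1`). [folklore] -/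
theorem residualSliceRep_flat [Nonempty n] {L : ℕ} [NeZero L] (hL : 1 ≤ L) (N k : ℕ) {α₀ : ℝ} (hα₀ : 0 ≤ α₀) :
    ResidualSliceRep (d := d) (n := n) L N k flatCfg flatCfg (fun _ => 1) (fun _ _ => 0) α₀ where
  gauge := ⟨fun _ => (unitaryUnits (Matrix n n ℂ)).one_mem, fun _ _ => rfl⟩
  cornerTrivial := fun _ => rfl
  rep := by rw [gaugeAct_one, vary_zero_dir]
  skew := fun _ _ => (skewAdjoint _).zero_mem
  per := fun _ _ _ => rfl
  hα₀ := hα₀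
  sup := fun _ _ => by rw [norm_zero]; exact hα₀
  frameFree := fun z => framePotW_flatCfg_zero hL k z
  orth := fun μ _ => by simp [hsR_zero_left]

/-! ## §2 The R-adapted residual slice representative at the flat datum -/

omit [Fintype n] [DecidableEq n] in
/-- `0 − 0 = 0` as bond fields. [folklore] -/
theorem zero_sub_zero_dir : (fun (_ : Site d) (_ : Fin d) => (0 : Matrix n n ℂ) - 0) = fun _ _ => 0 := by
  funext; rw [sub_zero]

/-- **NON-VACUITY OF `ResidualSliceRepT` AT THE FLAT DATUM**: `W = U_A = flatCfg`, `u = 1`, `X₀ = Nn = 0`, any `α₀ ≥ 0`. [folklore] -/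
theorem residualSliceRepT_flat [Nonempty n] {L : ℕ} [NeZero L] (hL : 1 ≤ L) (N k : ℕ) {α₀ : ℝ} (hα₀ : 0 ≤ α₀) :
    ResidualSliceRepT (d := d) (n := n) L N k flatCfg flatCfg (fun _ => 1) (fun _ _ => 0) (fun _ _ => 0) α₀ where
  gauge := ⟨fun _ => (unitaryUnits (Matrix n n ℂ)).one_mem, fun _ _ => rfl⟩
  cornerTrivial := fun _ => rfl
  rep := by rw [gaugeAct_one, vary_zero_dir]
  skew := fun _ _ => (skewAdjoint _).zero_mem
  per := fun _ _ _ => rfl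
  hα₀ := hα₀
  sup := fun _ _ => by rw [norm_zero]; exact hα₀
  tangent := by rw [zero_sub_zero_dir]; exact zero_mem_frameFreeBlockLandauW_flatCfg hL N k

/-- The same at the background `cavg L flatCfg` (`= flatCfg`), which is how file 2 reads `W`. [folklore] -/
theorem residualSliceRepT_flat_cavg [Nonempty n] {L : ℕ} [NeZero L] (hL : 1 ≤ L) (N k : ℕ) {α₀ : ℝ} (hα₀ : 0 ≤ α₀) :
    ResidualSliceRepT (d := d) (n := n) L N k (cavg L flatCfg) flatCfg (fun _ => 1) (fun _ _ => 0) (fun _ _ => 0) α₀ := by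
  rw [cavg_flatCfg]; exact residualSliceRepT_flat hL N k hα₀

/-! ## §3 The owner's file-2 END at the flat datum -/

/-- `normalPart 0 0 = 0` bondwise (`log (e^0 e^0) = log 1 = 0`). [folklore] -/
theorem normalPart_zero :
    normalPart (fun (_ : Site d) (_ : Fin d) => (0 : Matrix n n ℂ)) (fun _ _ => (0 : Matrix n n ℂ)) = fun _ _ => 0 := by
  funext y μ
  simp only [normalPart, NormedSpace.exp_zero, mul_one]
  exact MatrixLog.mlog_one

/-- **THE FILE-2 END `decomposedRep_of_linearNormalPart` FIRES AT THE FLAT DATUM** (`L, N ≥ 1`; `α₀ = αN = 0`; any pre-size letters `ν₀ k₁ k₂`;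
radius `a = 0`): all its binders — (J1), the three pre-sizes, `small` — hold at zero data. [folklore] -/
theorem decomposedRep_flat_of_linearNormalPart [Nonempty n] {L N : ℕ} [NeZero L] (hL : 1 ≤ L) (hN : 1 ≤ N) (j : ℕ) (ν₀ k₁ k₂ : ℝ) :
    DecomposedRep (flatClass (d := d) (n := n)) L N (j + 1) flatCfg flatCfg flatCfg (fun _ => 1)
      (fun y μ => (fun (_ : Site d) (_ : Fin d) => (0 : Matrix n n ℂ)) y μ - (fun (_ : Site d) (_ : Fin d) => (0 : Matrix n n ℂ)) y μ)
      (normalPart (fun _ _ => 0) fun y μ => (fun (_ : Site d) (_ : Fin d) => (0 : Matrix n n ℂ)) y μ - (fun (_ : Site d) (_ : Fin d) => (0 : Matrix n n ℂ)) y μ)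
      (0 + 0) ((1 + 2048 * (0 + 0)) * 0) ((1 + 2048 * Real.sqrt (16 * d + 1)) * ν₀) (k₁ + 8192 * d * k₂) (1806 * k₂) 0 := by
  have hWu : IsUnitaryCfg (cavg L (flatCfg (d := d) (n := n))) := by rw [cavg_flatCfg]; exact (flatCfg_classes le_rfl).1
  have hadm : cavg L (flatCfg (d := d) (n := n)) ∈ admissible flatClass L (j + 1) flatCfg := by
    rw [cavg_flatCfg]; exact flatCfg_mem_admissible L (j + 1)
  have hX0 : (fun y μ => (fun (_ : Site d) (_ : Fin d) => (0 : Matrix n n ℂ)) y μ - (fun (_ : Site d) (_ : Fin d) => (0 : Matrix n n ℂ)) y μ)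
      = fun _ _ => 0 := by funext; simp
  have hE : energyNormW L (j + 1) (cavg L (flatCfg (d := d) (n := n))) (fun _ _ => 0) (periodBox (d := d) (N * L ^ (j + 1))) = 0 :=
    energyNormW_zero L (j + 1) _ _
  refine decomposedRep_of_linearNormalPart hL hN j hWu hadm (residualSliceRepT_flat_cavg hL N (j + 1) le_rfl) (by norm_num)
    (fun _ _ _ => rfl) le_rfl (fun _ _ => by rw [norm_zero]) (by norm_num) (by norm_num) le_rfl ?_ ?_ ?_ ?_
  · -- (N1): `0 ≤ ν₀ · 0`
    rw [hE, hX0, hE, mul_zero]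
  · -- (N2): `0 · Σ‖curl 0‖ ≤ k₁ · 0²`
    rw [zero_mul, hX0, hE]; simp
  · -- (N3): `0 · (…) ≤ k₂ · 0²`
    rw [zero_mul, hX0, hE]; simp
  · -- `small`: the path of zero data is `0`, the flat plaquette variables are `1`
    intro t _ p _
    rw [hX0, normalPart_zero, pathΓ_zero_zero, vary_zero_dir, cavg_flatCfg, fhol_flatCfg, Units.val_one, sub_self, norm_zero]

end

end Summit.QuantumFields.BalabanUV.T4Continuum.NE3ResidualSliceRepFlat
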